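import Mathlib
import HarnessLib
import Summits.NavierStokesRegularity.NavierStokesRegularity.Theorems.PoloidalWindowDoorLrcModEntireRidgeWebImplicit

/-!
# Item `LrcModEntire` (stmt-NavierStokesRegularity-20428) — (Q4) entrance: THE WEB CURVES OF THE HOMOGENEOUS RIDGE WEB ARE DIFFERENTIABLE ARCS, and their tangents are
# NULL DIRECTIONS of the full Hessian of the slice (memo `Cruxes/LrcModEntire/T2B-g14.md` §10/§13b: the web sheet `S_t = ⋃_z Γ_{t,z}`)

ns-k2-port-2 g6 (helper prover under the LEAD of item 20428, ns-poloidal-K2-p3 g15; `--supports stmt-NavierStokesRegularity-20428 --as helper`).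
Input shape = output of `…RidgeWebClass.exists_hullLimit_ridgeWeb` (`F τ = σU₂(−1+τ,·)` jointly `C²` on `T × ℝ³`, `T ⊇ (−δ,δ)` open; limit branch `Γ ∈ C^∞` with normal
`ν_Γ = (−Γ′₁, Γ′₀, 0)`; strict concavity of the cross-sections on the open tube; a web point `n₀(τ,s,z) ∈ (−r,r)` maximising every cross-section — chosen by the consumer from
the web Fermat clause).  With `G(p, n) := F τ (Γ s + nν_Γ s + z e₂)`, `p = (τ, s, z)`, the class-free `…RidgeWebImplicit.hasStrictFDerivAt_criticalPoint` applies: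

* `contDiffAt_webSection`, `hasDerivAt_webSection_fibre`, `fderiv_webSection_fibre`, `fderiv_fderiv_webSection_fibre` — `G` is `C²` and its fibre derivatives are
  `D(F τ)(Ψ)[ν s]`, `D²(F τ)(Ψ)[ν s, ν s]`;
* `hasStrictFDerivAt_webPoint` — **the web point `n₀` is strictly differentiable in `(τ, s, z)`** on the window;
* `hasDerivAt_webCurve` — the web curve `c(s) = Γ s + n₀(τ,s,z)ν_Γ s + z e₂` is differentiable, `c′ = Γ′ + (∂ₛn₀)ν_Γ + n₀ν_Γ′`;
* `fderiv_slice_eq_of_fderiv_uncurry` — the web Fermat law `D(uncurry F)(τ,y) = A ∘ ((τ,y) ↦ (τ,y₂))` gives the slice gradient `D(F τ)(y) = A ∘ (h ↦ (0, h₂))`, the same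
  linear map at every web point of `Γ_{τ,z}`;
* `hessian_webCurve_tangent_eq_zero` — **if `D(F τ)` takes one value along the web curve then `D²(F τ)(c(s))[c′(s), ·] = 0`**: the tangent of `Γ_{τ,z}` is a null
  direction of the Hessian of the slice (horizontal block of rank one with kernel = tangent; the mixed derivative `∂_{c′}∂_z F τ` vanishes too).

WHAT THIS IS NOT: not a claim about Navier–Stokes regularity — kinematics of the hypothetical homogeneous null ridge of the research cell (Q4) (bears_on LADDER-NS N0, item 20428 /
crux 19708; 20428/19708/27893 OPEN; (Q4) OPEN).  No summit statement is proved here.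
-/

noncomputable section

-- the summit and its single sub-problem share the name (CONVENTIONS §1), as in every Theorems file
set_option linter.dupNamespace false

namespace Summit.NavierStokesRegularity.NavierStokesRegularity.Theorems.PoloidalWindowDoorLrcModEntireRidgeWebCurves

open Set Filter Topology Metric Function
open Summit.NavierStokesRegularity.NavierStokesRegularity.Theorems.PoloidalWindowDoorLrcModEntireRidgeWebImplicit

variable {F : ℝ → EuclideanSpace ℝ (Fin 3) → ℝ} {T : Set ℝ} {Γ ν : ℝ → EuclideanSpace ℝ (Fin 3)} {δ r : ℝ}

/-! ### The frame and the cross-section family `G(p, n) = F τ (Γ s + n ν s + z e₂)`, `p = (τ, s, z)` -/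

/-- The in-plane normal of a `C³` branch is `C²`. -/
theorem contDiff_two_normal (hΓ : ContDiff ℝ 3 Γ) (hν : ∀ s, ν s = WithLp.toLp 2 ![-(deriv Γ s 1), deriv Γ s 0, 0]) : ContDiff ℝ 2 ν := by
  have hd : ContDiff ℝ 2 (deriv Γ) := hΓ.deriv'
  have hd0 : ContDiff ℝ 2 fun s : ℝ => deriv Γ s 0 := (contDiff_piLp_apply (p := 2) (𝕜 := ℝ) (E := fun _ : Fin 3 => ℝ) (i := (0 : Fin 3))).comp hd
  have hd1 : ContDiff ℝ 2 fun s : ℝ => deriv Γ s 1 := (contDiff_piLp_apply (p := 2) (𝕜 := ℝ) (E := fun _ : Fin 3 => ℝ) (i := (1 : Fin 3))).comp hd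
  rw [show ν = fun s => WithLp.toLp 2 ![-(deriv Γ s 1), deriv Γ s 0, 0] from funext hν, contDiff_euclidean]
  intro i
  fin_cases i
  · simpa using hd1.neg
  · simpa using hd0
  · simp; exact contDiff_const

/-- The inner map `((τ,s,z), n) ↦ (τ, Γ s + n ν s + z e₂)` is `C²`. -/
theorem contDiff_webFrame (hΓ : ContDiff ℝ 3 Γ) (hν : ∀ s, ν s = WithLp.toLp 2 ![-(deriv Γ s 1), deriv Γ s 0, 0]) :
    ContDiff ℝ 2 fun v : (ℝ × ℝ × ℝ) × ℝ =>
      ((v.1.1, Γ v.1.2.1 + v.2 • ν v.1.2.1 + v.1.2.2 • EuclideanSpace.single 2 (1 : ℝ)) : ℝ × EuclideanSpace ℝ (Fin 3)) := by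
  have hΓ2 : ContDiff ℝ 2 Γ := hΓ.of_le (by norm_num)
  have hν2 := contDiff_two_normal hΓ hν
  refine (contDiff_fst.comp contDiff_fst).prodMk ?_
  refine ((hΓ2.comp ((contDiff_fst.comp contDiff_snd).comp contDiff_fst)).add ?_).add ?_
  · exact contDiff_snd.smul (hν2.comp ((contDiff_fst.comp contDiff_snd).comp contDiff_fst))
  · exact ((contDiff_snd.comp contDiff_snd).comp contDiff_fst).smul contDiff_const

/-- **The cross-section family is `C²`** at every `(p, n)` with `p.1 ∈ T`. -/
theorem contDiffAt_webSection (hT : IsOpen T) (hF : ContDiffOn ℝ 2 (uncurry F) (T ×ˢ (univ : Set (EuclideanSpace ℝ (Fin 3)))))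
    (hΓ : ContDiff ℝ 3 Γ) (hν : ∀ s, ν s = WithLp.toLp 2 ![-(deriv Γ s 1), deriv Γ s 0, 0]) {p : ℝ × ℝ × ℝ} (hp : p.1 ∈ T) (n : ℝ) :
    ContDiffAt ℝ 2 (fun v : (ℝ × ℝ × ℝ) × ℝ => F v.1.1 (Γ v.1.2.1 + v.2 • ν v.1.2.1 + v.1.2.2 • EuclideanSpace.single 2 (1 : ℝ))) (p, n) := by
  have hΦ := contDiff_webFrame hΓ hν
  have hmem : ((p.1, Γ p.2.1 + n • ν p.2.1 + p.2.2 • EuclideanSpace.single 2 (1 : ℝ)) : ℝ × EuclideanSpace ℝ (Fin 3)) ∈ T ×ˢ (univ : Set (EuclideanSpace ℝ (Fin 3))) :=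
    ⟨hp, mem_univ _⟩
  have hFat : ContDiffAt ℝ 2 (uncurry F) (p.1, Γ p.2.1 + n • ν p.2.1 + p.2.2 • EuclideanSpace.single 2 (1 : ℝ)) :=
    hF.contDiffAt ((hT.prod isOpen_univ).mem_nhds hmem)
  have h := hFat.comp (p, n) hΦ.contDiffAt
  exact h

/-- **First fibre derivative**: `n ↦ G(p, n)` has derivative `D(F τ)(Γ s + nν s + z e₂)[ν s]`. -/
theorem hasDerivAt_webSection_fibre {τ : ℝ} (hFτ : ContDiff ℝ 2 (F τ)) (s z n : ℝ) :
    HasDerivAt (fun m : ℝ => F τ (Γ s + m • ν s + z • EuclideanSpace.single 2 (1 : ℝ)))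
      (fderiv ℝ (F τ) (Γ s + n • ν s + z • EuclideanSpace.single 2 (1 : ℝ)) (ν s)) n := by
  have hl : HasDerivAt (fun m : ℝ => Γ s + m • ν s + z • EuclideanSpace.single 2 (1 : ℝ)) (ν s) n := by
    have h := (((hasDerivAt_id n).smul_const (ν s)).const_add (Γ s)).add_const (z • EuclideanSpace.single 2 (1 : ℝ))
    simpa using h
  exact ((hFτ.differentiable (by norm_num)) _).hasFDerivAt.comp_hasDerivAt n hl

/-- **Second fibre derivative of the straight cross-section**: `D²(F τ)(Γ s + nν s + z e₂)[ν s, ν s]`. -/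
theorem hasDerivAt_webSection_fibre_two {τ : ℝ} (hFτ : ContDiff ℝ 2 (F τ)) (s z n : ℝ) :
    HasDerivAt (fun m : ℝ => fderiv ℝ (F τ) (Γ s + m • ν s + z • EuclideanSpace.single 2 (1 : ℝ)) (ν s))
      (fderiv ℝ (fderiv ℝ (F τ)) (Γ s + n • ν s + z • EuclideanSpace.single 2 (1 : ℝ)) (ν s) (ν s)) n := by
  have hD1 : ContDiff ℝ 1 (fderiv ℝ (F τ)) := hFτ.fderiv_right le_rfl
  set A : (EuclideanSpace ℝ (Fin 3) →L[ℝ] ℝ) →L[ℝ] ℝ := ContinuousLinearMap.apply ℝ ℝ (ν s) with hA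
  set φ : EuclideanSpace ℝ (Fin 3) → ℝ := fun y => fderiv ℝ (F τ) y (ν s) with hφ
  have hφA : φ = A ∘ fderiv ℝ (F τ) := by funext y; simp [hφ, hA]
  have hφd : ∀ y, HasFDerivAt φ (A.comp (fderiv ℝ (fderiv ℝ (F τ)) y)) y := fun y => by
    rw [hφA]; exact A.hasFDerivAt.comp y ((hD1.differentiable one_ne_zero) y).hasFDerivAt
  have hl : HasDerivAt (fun m : ℝ => Γ s + m • ν s + z • EuclideanSpace.single 2 (1 : ℝ)) (ν s) n := by
    have h := (((hasDerivAt_id n).smul_const (ν s)).const_add (Γ s)).add_const (z • EuclideanSpace.single 2 (1 : ℝ))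
    simpa using h
  have h := (hφd _).comp_hasDerivAt n hl
  have e2 : (A.comp (fderiv ℝ (fderiv ℝ (F τ)) (Γ s + n • ν s + z • EuclideanSpace.single 2 (1 : ℝ)))) (ν s) =
      fderiv ℝ (fderiv ℝ (F τ)) (Γ s + n • ν s + z • EuclideanSpace.single 2 (1 : ℝ)) (ν s) (ν s) := by simp [hA]
  rw [e2] at h
  exact h

/-! ### The web point is strictly differentiable -/

/-- **THE WEB POINT IS STRICTLY DIFFERENTIABLE IN `(τ, s, z)`.**  `uncurry F ∈ C²(T × ℝ³)`, `T` open `⊇ (−δ, δ)`; `Γ ∈ C³` with in-plane normal `ν`; strict concavity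
`D²(F τ)(Γ s + nν s + z e₂)[ν s, ν s] < 0` for `|τ|,|z| < δ`, `|n| < r`; `n₀(τ,s,z) ∈ (−r,r)` maximising the cross-section over `[−r,r]`.  Then `n₀` has a strict derivative
at every point of the window `{|τ| < δ, |z| < δ}`. -/
theorem hasStrictFDerivAt_webPoint (hT : IsOpen T) (hF : ContDiffOn ℝ 2 (uncurry F) (T ×ˢ (univ : Set (EuclideanSpace ℝ (Fin 3))))) (hδT : Ioo (-δ) δ ⊆ T)
    (hΓ : ContDiff ℝ 3 Γ) (hν : ∀ s, ν s = WithLp.toLp 2 ![-(deriv Γ s 1), deriv Γ s 0, 0])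
    (hconc : ∀ τ z : ℝ, |τ| < δ → |z| < δ → ∀ s : ℝ, ∀ n ∈ Ioo (-r) r,
      fderiv ℝ (fderiv ℝ (F τ)) (Γ s + n • ν s + z • EuclideanSpace.single 2 (1 : ℝ)) (ν s) (ν s) < 0)
    {n₀ : ℝ × ℝ × ℝ → ℝ}
    (hn₀ : ∀ p : ℝ × ℝ × ℝ, |p.1| < δ → |p.2.2| < δ → n₀ p ∈ Ioo (-r) r ∧
      ∀ n ∈ Icc (-r) r, F p.1 (Γ p.2.1 + n • ν p.2.1 + p.2.2 • EuclideanSpace.single 2 (1 : ℝ)) ≤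
        F p.1 (Γ p.2.1 + n₀ p • ν p.2.1 + p.2.2 • EuclideanSpace.single 2 (1 : ℝ)))
    {p₀ : ℝ × ℝ × ℝ} (hτ₀ : |p₀.1| < δ) (hz₀ : |p₀.2.2| < δ) :
    ∃ L : ℝ × ℝ × ℝ →L[ℝ] ℝ, HasStrictFDerivAt n₀ L p₀ := by
  set V : Set (ℝ × ℝ × ℝ) := {p | |p.1| < δ ∧ |p.2.2| < δ} with hV
  have hVo : IsOpen V := (isOpen_lt (continuous_fst.abs) continuous_const).inter (isOpen_lt ((continuous_snd.comp continuous_snd).abs) continuous_const)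
  have hp₀ : p₀ ∈ V := ⟨hτ₀, hz₀⟩
  set G : (ℝ × ℝ × ℝ) × ℝ → ℝ := fun v => F v.1.1 (Γ v.1.2.1 + v.2 • ν v.1.2.1 + v.1.2.2 • EuclideanSpace.single 2 (1 : ℝ)) with hG
  have hT' : ∀ p ∈ V, p.1 ∈ T := fun p hp => hδT ⟨(abs_lt.1 hp.1).1, (abs_lt.1 hp.1).2⟩
  have hFτ : ∀ p ∈ V, ContDiff ℝ 2 (F p.1) := fun p hp => by
    have h : ContDiffOn ℝ 2 (uncurry F ∘ fun y : EuclideanSpace ℝ (Fin 3) => (p.1, y)) univ :=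
      hF.comp (contDiff_const.prodMk contDiff_id).contDiffOn fun y _ => ⟨hT' p hp, mem_univ _⟩
    rw [contDiffOn_univ] at h; exact h
  have hGc : ∀ p ∈ V, ∀ n ∈ Ioo (-r) r, ContDiffAt ℝ 2 G (p, n) := fun p hp n _ => contDiffAt_webSection hT hF hΓ hν (hT' p hp) n
  -- the fibre derivatives of `G`
  have hG1 : ∀ p ∈ V, ∀ n : ℝ, fderiv ℝ G (p, n) ((0 : ℝ × ℝ × ℝ), (1 : ℝ)) =
      fderiv ℝ (F p.1) (Γ p.2.1 + n • ν p.2.1 + p.2.2 • EuclideanSpace.single 2 (1 : ℝ)) (ν p.2.1) := by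
    intro p hp n
    have hGd : DifferentiableAt ℝ G (p, n) := (contDiffAt_webSection hT hF hΓ hν (hT' p hp) n).differentiableAt (by norm_num)
    have hι : HasDerivAt (fun m : ℝ => ((p, m) : (ℝ × ℝ × ℝ) × ℝ)) ((0 : ℝ × ℝ × ℝ), (1 : ℝ)) n :=
      (hasDerivAt_const n p).prodMk (hasDerivAt_id n)
    have h1 := hGd.hasFDerivAt.comp_hasDerivAt n hι
    have h2 := hasDerivAt_webSection_fibre (Γ := Γ) (ν := ν) (hFτ p hp) p.2.1 p.2.2 n
    exact h1.unique h2
  have hG2 : ∀ p ∈ V, ∀ n ∈ Ioo (-r) r, fderiv ℝ (fderiv ℝ G) (p, n) ((0 : ℝ × ℝ × ℝ), (1 : ℝ)) ((0 : ℝ × ℝ × ℝ), (1 : ℝ)) =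
      fderiv ℝ (fderiv ℝ (F p.1)) (Γ p.2.1 + n • ν p.2.1 + p.2.2 • EuclideanSpace.single 2 (1 : ℝ)) (ν p.2.1) (ν p.2.1) := by
    intro p hp n hn
    have hGd2 : DifferentiableAt ℝ (fderiv ℝ G) (p, n) := (((hGc p hp n hn).fderiv_right (m := 1) le_rfl).differentiableAt (by simp))
    have h1 := hasDerivAt_partial_fibre hGd2
    -- the fibre derivative function agrees with the straight cross-section derivative near `n`
    have hEq : (fun m : ℝ => fderiv ℝ G (p, m) ((0 : ℝ × ℝ × ℝ), (1 : ℝ))) =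
        fun m : ℝ => fderiv ℝ (F p.1) (Γ p.2.1 + m • ν p.2.1 + p.2.2 • EuclideanSpace.single 2 (1 : ℝ)) (ν p.2.1) := funext fun m => hG1 p hp m
    rw [hEq] at h1
    exact h1.unique (hasDerivAt_webSection_fibre_two (Γ := Γ) (ν := ν) (hFτ p hp) p.2.1 p.2.2 n)
  have hconcG : ∀ p ∈ V, ∀ n ∈ Ioo (-r) r, fderiv ℝ (fderiv ℝ G) (p, n) ((0 : ℝ × ℝ × ℝ), (1 : ℝ)) ((0 : ℝ × ℝ × ℝ), (1 : ℝ)) < 0 :=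
    fun p hp n hn => by rw [hG2 p hp n hn]; exact hconc p.1 p.2.2 hp.1 hp.2 p.2.1 n hn
  -- criticality of the web point (interior maximum of the cross-section)
  have hn₀V : ∀ p ∈ V, n₀ p ∈ Ioo (-r) r := fun p hp => (hn₀ p hp.1 hp.2).1
  have hcrit : ∀ p ∈ V, fderiv ℝ G (p, n₀ p) ((0 : ℝ × ℝ × ℝ), (1 : ℝ)) = 0 := by
    intro p hp
    obtain ⟨hin, hmax⟩ := hn₀ p hp.1 hp.2
    have hloc : IsLocalMax (fun m : ℝ => F p.1 (Γ p.2.1 + m • ν p.2.1 + p.2.2 • EuclideanSpace.single 2 (1 : ℝ))) (n₀ p) := by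
      have hI : Icc (-r) r ∈ 𝓝 (n₀ p) := Icc_mem_nhds hin.1 hin.2
      exact Filter.eventually_of_mem hI fun m hm => hmax m hm
    rw [hG1 p hp, ← (hasDerivAt_webSection_fibre (Γ := Γ) (ν := ν) (hFτ p hp) p.2.1 p.2.2 (n₀ p)).deriv]
    exact hloc.deriv_eq_zero
  exact ⟨_, hasStrictFDerivAt_criticalPoint hVo hGc hconcG hn₀V hcrit hp₀⟩

/-! ### The web curves and their tangents -/

/-- **The web curve `c(s) = Γ s + n₀(τ,s,z)ν s + z e₂` is differentiable**, `c′(s) = Γ′ s + (∂ₛn₀)ν s + n₀ ν′ s`, whenever `n₀(τ,·,z)` is differentiable at `s`. -/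
theorem hasDerivAt_webCurve (hΓ : ContDiff ℝ 3 Γ) (hν : ∀ s, ν s = WithLp.toLp 2 ![-(deriv Γ s 1), deriv Γ s 0, 0]) {m : ℝ → ℝ} {s m' : ℝ}
    (hm : HasDerivAt m m' s) (z : ℝ) :
    HasDerivAt (fun a : ℝ => Γ a + m a • ν a + z • EuclideanSpace.single 2 (1 : ℝ))
      (deriv Γ s + (m' • ν s + m s • deriv ν s)) s := by
  have hΓd : Differentiable ℝ Γ := hΓ.differentiable (by norm_num)
  have hνd : Differentiable ℝ ν := (contDiff_two_normal hΓ hν).differentiable (by norm_num)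
  have h1 : HasDerivAt Γ (deriv Γ s) s := (hΓd s).hasDerivAt
  have h2 : HasDerivAt (fun a => m a • ν a) (m s • deriv ν s + m' • ν s) s := hm.smul (hνd s).hasDerivAt
  have h := (h1.add h2).add_const (z • EuclideanSpace.single 2 (1 : ℝ))
  have e : m s • deriv ν s + m' • ν s = m' • ν s + m s • deriv ν s := add_comm _ _
  rw [e] at h
  exact h

/-- **The slice gradient from the web Fermat law**: `D(uncurry F)(τ, y) = A ∘ ((τ,y) ↦ (τ,y₂))` with `uncurry F` differentiable at `(τ, y)` ⇒
`D(F τ)(y) = A ∘ (h ↦ (0, h₂))` — one linear map for all web points of `Γ_{τ,z}` (`A = D(uncurry R)(τ,z)`). -/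
theorem fderiv_slice_eq_of_fderiv_uncurry {τ : ℝ} {y : EuclideanSpace ℝ (Fin 3)} (hFd : DifferentiableAt ℝ (uncurry F) (τ, y)) {A : ℝ × ℝ →L[ℝ] ℝ}
    (h : fderiv ℝ (uncurry F) (τ, y) =
      A.comp ((ContinuousLinearMap.fst ℝ ℝ (EuclideanSpace ℝ (Fin 3))).prod
        ((EuclideanSpace.proj (2 : Fin 3)).comp (ContinuousLinearMap.snd ℝ ℝ (EuclideanSpace ℝ (Fin 3)))))) :
    fderiv ℝ (F τ) y = A.comp ((ContinuousLinearMap.inr ℝ ℝ ℝ).comp (EuclideanSpace.proj (2 : Fin 3))) := by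
  have hι : HasFDerivAt (fun w : EuclideanSpace ℝ (Fin 3) => ((τ, w) : ℝ × EuclideanSpace ℝ (Fin 3)))
      (ContinuousLinearMap.inr ℝ ℝ (EuclideanSpace ℝ (Fin 3))) y := hasFDerivAt_prodMk_right τ y
  have hc := hFd.hasFDerivAt.comp y hι
  have e : (uncurry F ∘ fun w : EuclideanSpace ℝ (Fin 3) => ((τ, w) : ℝ × EuclideanSpace ℝ (Fin 3))) = F τ := by funext w; rfl
  rw [e] at hc
  rw [hc.fderiv, h]
  ext w
  simp

/-- **THE TANGENT OF A WEB CURVE IS A NULL DIRECTION OF THE HESSIAN OF THE SLICE.**  `F τ ∈ C²`; a curve `c` differentiable at `s` with `c′(s) = w`; the slice gradient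
`D(F τ)(c(a))` takes ONE value `B` for `a` near `s` ⇒ `D²(F τ)(c(s))[w] = 0` (as a linear form: `D²(F τ)(c s)[w, ·] = 0`). -/
theorem hessian_webCurve_tangent_eq_zero {τ : ℝ} (hFτ : ContDiff ℝ 2 (F τ)) {c : ℝ → EuclideanSpace ℝ (Fin 3)} {s : ℝ} {w : EuclideanSpace ℝ (Fin 3)}
    (hc : HasDerivAt c w s) {B : EuclideanSpace ℝ (Fin 3) →L[ℝ] ℝ} (hB : ∀ᶠ a in 𝓝 s, fderiv ℝ (F τ) (c a) = B) :
    fderiv ℝ (fderiv ℝ (F τ)) (c s) w = 0 := by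
  have hD1 : ContDiff ℝ 1 (fderiv ℝ (F τ)) := hFτ.fderiv_right le_rfl
  have h1 : HasDerivAt (fun a => fderiv ℝ (F τ) (c a)) (fderiv ℝ (fderiv ℝ (F τ)) (c s) w) s :=
    ((hD1.differentiable one_ne_zero) (c s)).hasFDerivAt.comp_hasDerivAt s hc
  have h2 : HasDerivAt (fun a => fderiv ℝ (F τ) (c a)) 0 s := by
    have hconst : (fun a => fderiv ℝ (F τ) (c a)) =ᶠ[𝓝 s] fun _ => B := hB
    exact (hasDerivAt_const s B).congr_of_eventuallyEq hconst
  exact h1.unique h2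

/-! ## Appended (port-2 g6, 12:1xZ): the vertical and the time directions of the web sheet

* `hasDerivAt_webSheet_z`, `hessian_apply_eq_zero_of_const_dir`, `twist_eq_slope_mul_curvature` — a direction along which ONE directional derivative of the slice is constant
  is Hessian-orthogonal to it; on the sheet the twist `∂_z∂_ν(F τ)` equals `(∂_z n₀)·κ_ν` (vertical slope × transversal curvature);
* `hessian_apply_eq_zero_of_const_dir'`, `fderiv_slice_apply_eq_uncurry`, `spacetimeHessian_sheetVelocity_normal_eq_zero` — the SHEET-SPEED LAW
  `D²(uncurry F)(τ,y₀)[(1, Vν s), (0, ν s)] = 0` (`V = ∂_τ n₀`), i.e. `V·κ_ν = ∂_ν∂ₜ(σU₂)` at the web point — the kinematic input of mechanism M1 (web transport, T2B-g14 §14b).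
-/

/-! ### The vertical direction of the web sheet -/

/-- **The vertical web section `z ↦ Γ s + n₀(τ,s,z)ν s + z e₂` is differentiable**, with derivative `(∂_z n₀)ν s + e₂`, whenever `n₀(τ,s,·)` is differentiable at `z`. -/
theorem hasDerivAt_webSheet_z {m : ℝ → ℝ} {z m' : ℝ} (hm : HasDerivAt m m' z) (s : ℝ) :
    HasDerivAt (fun b : ℝ => Γ s + m b • ν s + b • EuclideanSpace.single 2 (1 : ℝ))
      (m' • ν s + EuclideanSpace.single 2 (1 : ℝ)) z := by
  have h1 : HasDerivAt (fun b : ℝ => m b • ν s) (m' • ν s) z := hm.smul_const (ν s)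
  have h2 : HasDerivAt (fun b : ℝ => b • (EuclideanSpace.single 2 (1 : ℝ) : EuclideanSpace ℝ (Fin 3)))
      (EuclideanSpace.single 2 (1 : ℝ) : EuclideanSpace ℝ (Fin 3)) z := by
    simpa using (hasDerivAt_id z).smul_const (EuclideanSpace.single 2 (1 : ℝ) : EuclideanSpace ℝ (Fin 3))
  have h := (h1.add h2).const_add (Γ s)
  simpa [add_assoc] using h

/-- **A direction along which ONE directional derivative of the slice is constant is Hessian-orthogonal to it**: `F τ ∈ C²`, a curve `c` with `c′(s) = w`, and
`a ↦ D(F τ)(c a)[h]` constant near `s` (one fixed `h`) ⇒ `D²(F τ)(c s)[w, h] = 0`.  Instances on the web sheet (the horizontal gradient vanishes at EVERY web point, all `s`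
and all `z`): along the web curve (`w = c′`) and along the vertical web section (`w = (∂_z n₀)ν s + e₂`) the mixed second derivatives with every HORIZONTAL `h` vanish — in
particular the twist `∂_ν∂_z(F τ) = −(∂_z n₀)·D²(F τ)[ν s, ν s]` on the sheet. -/
theorem hessian_apply_eq_zero_of_const_dir {τ : ℝ} (hFτ : ContDiff ℝ 2 (F τ)) {c : ℝ → EuclideanSpace ℝ (Fin 3)} {s : ℝ} {w h : EuclideanSpace ℝ (Fin 3)}
    (hc : HasDerivAt c w s) {b : ℝ} (hb : ∀ᶠ a in 𝓝 s, fderiv ℝ (F τ) (c a) h = b) :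
    fderiv ℝ (fderiv ℝ (F τ)) (c s) w h = 0 := by
  have hD1 : ContDiff ℝ 1 (fderiv ℝ (F τ)) := hFτ.fderiv_right le_rfl
  set A : (EuclideanSpace ℝ (Fin 3) →L[ℝ] ℝ) →L[ℝ] ℝ := ContinuousLinearMap.apply ℝ ℝ h with hA
  have h1 : HasDerivAt (fun a => fderiv ℝ (F τ) (c a) h) (fderiv ℝ (fderiv ℝ (F τ)) (c s) w h) s := by
    have hcomp := ((hD1.differentiable one_ne_zero) (c s)).hasFDerivAt.comp_hasDerivAt s hc
    have h2 := (A.hasFDerivAt.comp_hasDerivAt s hcomp)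
    have e : (⇑A ∘ fderiv ℝ (F τ) ∘ c) = fun a => fderiv ℝ (F τ) (c a) h := by funext a; simp [hA]
    rw [e] at h2
    simpa [hA] using h2
  have h2 : HasDerivAt (fun a => fderiv ℝ (F τ) (c a) h) 0 s :=
    (hasDerivAt_const s b).congr_of_eventuallyEq hb
  exact h1.unique h2

/-- **The twist on the web sheet.**  With `κν := −D²(F τ)(c)[ν s, ν s]` and the vertical web section `c(b) = Γ s + m b ν s + b e₂` (`m = n₀(τ,s,·)`, `m′ = ∂_z n₀`): if the
normal derivative `D(F τ)(c b)[ν s]` vanishes for `b` near `z` (web points are horizontally critical) then `D²(F τ)(c z)[e₂, ν s] = m′·κν` — the twist coefficient of the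
lever along the sheet is the sheet's vertical slope times the transversal curvature. -/
theorem twist_eq_slope_mul_curvature {τ : ℝ} (hFτ : ContDiff ℝ 2 (F τ)) {m : ℝ → ℝ} {z m' : ℝ} (hm : HasDerivAt m m' z) (s : ℝ)
    (hcrit : ∀ᶠ b in 𝓝 z, fderiv ℝ (F τ) (Γ s + m b • ν s + b • EuclideanSpace.single 2 (1 : ℝ)) (ν s) = 0) :
    fderiv ℝ (fderiv ℝ (F τ)) (Γ s + m z • ν s + z • EuclideanSpace.single 2 (1 : ℝ)) (EuclideanSpace.single 2 (1 : ℝ)) (ν s) =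
      m' * -(fderiv ℝ (fderiv ℝ (F τ)) (Γ s + m z • ν s + z • EuclideanSpace.single 2 (1 : ℝ)) (ν s) (ν s)) := by
  have h := hessian_apply_eq_zero_of_const_dir (F := F) hFτ (hasDerivAt_webSheet_z (Γ := Γ) (ν := ν) hm s) (b := 0) hcrit
  rw [map_add, map_smul] at h
  have h' : m' * fderiv ℝ (fderiv ℝ (F τ)) (Γ s + m z • ν s + z • EuclideanSpace.single 2 (1 : ℝ)) (ν s) (ν s) +
      fderiv ℝ (fderiv ℝ (F τ)) (Γ s + m z • ν s + z • EuclideanSpace.single 2 (1 : ℝ)) (EuclideanSpace.single 2 (1 : ℝ)) (ν s) = 0 := by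
    simpa using h
  linarith

/-! ### The time direction: the sheet-speed law -/

/-- General form of the Hessian-orthogonality principle: `f : E → ℝ` of class `C²` at `C s`, a curve `C` with `C′(s) = w`, and `a ↦ Df(C a)[h]` constant near `s`
⇒ `D²f(C s)[w, h] = 0`. [folklore] -/
theorem hessian_apply_eq_zero_of_const_dir' {E : Type*} [NormedAddCommGroup E] [NormedSpace ℝ E] {f : E → ℝ} {C : ℝ → E} {s : ℝ} {w h : E}
    (hf : ContDiffAt ℝ 2 f (C s)) (hC : HasDerivAt C w s) {b : ℝ} (hb : ∀ᶠ a in 𝓝 s, fderiv ℝ f (C a) h = b) :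
    fderiv ℝ (fderiv ℝ f) (C s) w h = 0 := by
  have hD : DifferentiableAt ℝ (fderiv ℝ f) (C s) := (hf.fderiv_right (m := 1) le_rfl).differentiableAt (by simp)
  set A : (E →L[ℝ] ℝ) →L[ℝ] ℝ := ContinuousLinearMap.apply ℝ ℝ h with hA
  have h1 : HasDerivAt (fun a => fderiv ℝ f (C a) h) (fderiv ℝ (fderiv ℝ f) (C s) w h) s := by
    have hcomp := hD.hasFDerivAt.comp_hasDerivAt s hC
    have h2 := A.hasFDerivAt.comp_hasDerivAt s hcomp
    have e : (⇑A ∘ fderiv ℝ f ∘ C) = fun a => fderiv ℝ f (C a) h := by funext a; simp [hA]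
    rw [e] at h2
    simpa [hA] using h2
  have h2 : HasDerivAt (fun a => fderiv ℝ f (C a) h) 0 s := (hasDerivAt_const s b).congr_of_eventuallyEq hb
  exact h1.unique h2

/-- Slice derivative through the space–time derivative: `D(F a)(y)[h] = D(uncurry F)(a, y)[(0, h)]` when `uncurry F` is differentiable at `(a, y)`. -/
theorem fderiv_slice_apply_eq_uncurry {a : ℝ} {y : EuclideanSpace ℝ (Fin 3)} (hFd : DifferentiableAt ℝ (uncurry F) (a, y)) (h : EuclideanSpace ℝ (Fin 3)) :
    fderiv ℝ (F a) y h = fderiv ℝ (uncurry F) (a, y) ((0 : ℝ), h) := by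
  have hι : HasFDerivAt (fun w : EuclideanSpace ℝ (Fin 3) => ((a, w) : ℝ × EuclideanSpace ℝ (Fin 3)))
      (ContinuousLinearMap.inr ℝ ℝ (EuclideanSpace ℝ (Fin 3))) y := hasFDerivAt_prodMk_right a y
  have hc := hFd.hasFDerivAt.comp y hι
  have e : (uncurry F ∘ fun w : EuclideanSpace ℝ (Fin 3) => ((a, w) : ℝ × EuclideanSpace ℝ (Fin 3))) = F a := by funext w; rfl
  rw [e] at hc
  rw [hc.fderiv]; rfl

/-- **THE SHEET-SPEED LAW (kinematic).**  `uncurry F ∈ C²(T × ℝ³)`, `τ ∈ T` open; the web point moves in time along the normal, `m(a) = n₀(a, s, z)` differentiable at `τ`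
with derivative `V` (`…hasStrictFDerivAt_webPoint`); web points are normally critical, `D(F a)(Γ s + m(a)ν s + z e₂)[ν s] = 0` for `a` near `τ`.  Then the space–time
Hessian annihilates the pair (sheet velocity vector, normal): **`D²(uncurry F)(τ, y₀)[(1, V ν s), (0, ν s)] = 0`**, i.e. `∂_ν(∂ₜF)(y₀) + V·D²(F τ)(y₀)[ν s, ν s] = 0`:
the web's normal speed is `V = ∂_ν∂ₜ(σU₂)/κ_ν` — the quantity the mechanism M1 (web transport, memo T2B-g14 §14b) compares with the fluid's normal velocity. -/
theorem spacetimeHessian_sheetVelocity_normal_eq_zero (hT : IsOpen T) (hF : ContDiffOn ℝ 2 (uncurry F) (T ×ˢ (univ : Set (EuclideanSpace ℝ (Fin 3)))))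
    {τ : ℝ} (hτ : τ ∈ T) {m : ℝ → ℝ} {V : ℝ} (hm : HasDerivAt m V τ) (s z : ℝ)
    (hcrit : ∀ᶠ a in 𝓝 τ, fderiv ℝ (F a) (Γ s + m a • ν s + z • EuclideanSpace.single 2 (1 : ℝ)) (ν s) = 0) :
    fderiv ℝ (fderiv ℝ (uncurry F)) (τ, Γ s + m τ • ν s + z • EuclideanSpace.single 2 (1 : ℝ)) ((1 : ℝ), V • ν s) ((0 : ℝ), ν s) = 0 := by
  set C : ℝ → ℝ × EuclideanSpace ℝ (Fin 3) := fun a => (a, Γ s + m a • ν s + z • EuclideanSpace.single 2 (1 : ℝ)) with hCdef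
  have hC : HasDerivAt C ((1 : ℝ), V • ν s) τ := by
    have h2 : HasDerivAt (fun a : ℝ => Γ s + m a • ν s + z • EuclideanSpace.single 2 (1 : ℝ)) (V • ν s) τ := by
      have h := ((hm.smul_const (ν s)).const_add (Γ s)).add_const (z • EuclideanSpace.single 2 (1 : ℝ))
      simpa using h
    exact (hasDerivAt_id τ).prodMk h2
  have hmemT : ∀ᶠ a in 𝓝 τ, a ∈ T := hT.mem_nhds hτ
  have hf : ContDiffAt ℝ 2 (uncurry F) (C τ) := hF.contDiffAt ((hT.prod isOpen_univ).mem_nhds ⟨hτ, mem_univ _⟩)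
  have hb : ∀ᶠ a in 𝓝 τ, fderiv ℝ (uncurry F) (C a) ((0 : ℝ), ν s) = 0 := by
    filter_upwards [hmemT, hcrit] with a ha hca
    have hFd : DifferentiableAt ℝ (uncurry F) (a, Γ s + m a • ν s + z • EuclideanSpace.single 2 (1 : ℝ)) :=
      (hF.differentiableOn (by simp)).differentiableAt ((hT.prod isOpen_univ).mem_nhds ⟨ha, mem_univ _⟩)
    rw [hCdef, ← fderiv_slice_apply_eq_uncurry hFd]
    exact hca
  exact hessian_apply_eq_zero_of_const_dir' hf hC hb

end Summit.NavierStokesRegularity.NavierStokesRegularity.Theorems.PoloidalWindowDoorLrcModEntireRidgeWebCurves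

end
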